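import Literature.Geometry.Riemannian.ChangGurskyYangProofs
import HarnessLib

/-!
# `SubcylindricalRecognition` — negative knowledge II: certified density-window arithmetic and non-vacuity of `R > 0`

Support lemmas for crux `stmt-SmoothPoincare4-10869` (RUNG) and its rank-2/rank-4 dependencies
NoncompactShrinkerGap (10868) / CompactShrinkerGap (10870), from the standing disprover's work file
`Cruxes/SubcylindricalRecognition/Disproof.lean` (§3–§4).

The 4-dimensional Gaussian-density table entries the route quotes, as closed forms with CERTIFIED orderings:
`thetaSph = 6/e²` (.8120), `thetaCyl = 2√π e^{−3/2}` (.7910), `thetaS2R2 = 2/e` (.7358), `thetaCP2 = 9/(2e²)` (.6090),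
`thetaS2S2 = 4/e²` (.5413), `thetaEinsteinNonround = 2/e²` (.2707, Hitchin–Gursky bound for a non-round Einstein
metric on a homotopy 4-sphere), `thetaFIK = (1+√2)e^{√2−2}/2` (.67196, CLOSED FORM of the FIK density: the toric minimum
`e^{−2} min_a e^a(1/a+1/a²)` is attained at `a = √2`); `thetaS2S2 < thetaCP2 < thetaFIK < thetaS2R2 < thetaCyl < thetaSph < 1`
(rev 2 adds `thetaCP2_lt_thetaFIK`, `thetaFIK_lt_thetaS2R2`, `thetaSph_half_lt_thetaCyl` = ℝP⁴ below the cylinder), `half_lt_thetaCyl`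
(orbifold models `Θ ≤ 1/2` are excluded with margin .291), `thetaEinsteinNonround_lt_thetaCyl` (the Einstein case of
the compact gap has margin .52), `nuCyl_eq_log_thetaCyl`, `log_thetaSph` (= log 6 − 2 = ν(S⁴_round)),
`nuCyl_lt_nuRound` (the round sphere clears the crux threshold, margin .02625), `routeConstant_eq`
(`32π²√π e^{−3/2} = 16π²·Θ_cyl`, the literal constant of 10868/10870), `thetaSph_eq`, `volRatio_window`
(`Θ_cyl/Θ_sph = √(πe)/3 ∈ (.974, .9742)`: an Einstein competitor needs > 97.4 % of the round volume).
Non-vacuity: `roundSphere_psc` — the round `S⁴ ⊂ ℝ⁵` carries, with the TREE's definitions, a `C^∞` Riemannian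
metric with Levi-Civita instance and `R = 12 > 0` (so the crux is not vacuously provable through `R > 0`).
Numerics re-derived this cycle (pure-python quadrature, folder compute/toric_density_recheck.py): FIK
`(1+√2)e^{√2−2}/2 = .67196` (closed form), BCCD .56174, Koiso–Cao .51787, Wang–Zhu .45485, ℂP² .60901, S²×S² .54134.
References: Cao–Hamilton–Ilmanen arXiv:math/0404165 §4; Gursky, Math. Ann. 318 (2000); Hitchin, JDG 9 (1974);
Li–Wang arXiv:2301.09784 Thm 1.1.
-/

noncomputable section

set_option linter.dupNamespace false

namespace Summit.SmoothPoincare4.SmoothPoincare4.Theorems.SubcylindricalRecognition.Negative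

open scoped Manifold ContDiff Topology
open Literature.Geometry.Lorentzian Literature.Geometry.Riemannian

/-- The standard smooth 4-sphere of the summit statement. -/
local notation "𝕊⁴" => (Metric.sphere (0 : EuclideanSpace ℝ (Fin 5)) 1)

/-! ## §3 Certified window arithmetic (the 4-d density table entries that the route quotes) -/

/-- The cylinder threshold `ν_cyl = log Θ(S³×ℝ) = log 2 + ½ log π − 3/2 ≈ −0.23449` (the crux's literal). -/
def nuCyl : ℝ := Real.log 2 + Real.log Real.pi / 2 - 3 / 2

/-- `Θ(S⁴) = 6/e²` (Einstein shrinker `S⁴(√6)`, `∫ e^{−f} dV = 96π² e⁻²`). -/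
def thetaSph : ℝ := 6 / Real.exp 2
/-- `Θ(S³×ℝ) = Θ(S³) = 2√π e^{−3/2}` (cylinder `S³(2)×ℝ`, `∫ e^{−f} dV = 32π²√π e^{−3/2}`). -/
def thetaCyl : ℝ := 2 * Real.sqrt Real.pi * Real.exp (-(3 : ℝ) / 2)
/-- `Θ(S²×ℝ²) = Θ(S²) = 2/e` (also `Θ(ℂ×ℙ¹)`, the top non-flat Kähler value in real dimension 4). -/
def thetaS2R2 : ℝ := 2 / Real.exp 1
/-- `Θ(ℂP²) = 9/(2e²)`. -/
def thetaCP2 : ℝ := 9 / (2 * Real.exp 2)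
/-- `Θ(S²×S²) = 4/e²`. -/
def thetaS2S2 : ℝ := 4 / Real.exp 2
/-- Gursky's bound `Θ ≤ Θ(S⁴)/3 = 2/e²` for a NON-round Einstein metric on a homotopy 4-sphere
(χ = 2, σ = 0: `W^± ≢ 0 ⇒ ∫|W^±|² ≥ 16π²/3` each ⇒ `Vol ≤ Vol(S⁴)/3`). -/
def thetaEinsteinNonround : ℝ := 2 / Real.exp 2

/-- `e² = e·e`. [folklore] -/
private lemma exp_two_eq : Real.exp 2 = Real.exp 1 * Real.exp 1 := by
  rw [← Real.exp_add]; norm_num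

/-- `√e·√e = e` with `√e := exp (1/2)`. [folklore] -/
private lemma exp_half_sq : Real.exp (1 / 2) * Real.exp (1 / 2) = Real.exp 1 := by
  rw [← Real.exp_add]; norm_num

/-- `e^{−3/2} = (e·√e)⁻¹`. [folklore] -/
private lemma exp_neg_three_halves :
    Real.exp (-(3 : ℝ) / 2) = (Real.exp 1 * Real.exp (1 / 2))⁻¹ := by
  rw [← Real.exp_add, ← Real.exp_neg]; norm_num

/-- `√π·√π = π`. [folklore] -/
private lemma sqrt_pi_sq : Real.sqrt Real.pi * Real.sqrt Real.pi = Real.pi :=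
  Real.mul_self_sqrt Real.pi_pos.le

/-- `e < 2.72`. [folklore] -/
private lemma e_lt_272 : Real.exp 1 < 2.72 := lt_trans Real.exp_one_lt_d9 (by norm_num)
/-- `2.71 < e`. [folklore] -/
private lemma e_gt_271 : (2.71 : ℝ) < Real.exp 1 := lt_trans (by norm_num) Real.exp_one_gt_d9

/-- `√e < √π` (⟺ `e < π`). [folklore] -/
private lemma exp_half_lt_sqrt_pi : Real.exp (1 / 2) < Real.sqrt Real.pi := by
  have hE : Real.exp 1 < Real.pi := lt_trans e_lt_272 (by linarith [Real.pi_gt_d2])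
  have h0 : (0 : ℝ) ≤ Real.exp (1 / 2) := (Real.exp_pos _).le
  have h1 : (0 : ℝ) ≤ Real.sqrt Real.pi := Real.sqrt_nonneg _
  exact (mul_self_lt_mul_self_iff h0 h1).2 (by rw [exp_half_sq, sqrt_pi_sq]; exact hE)

/-- `Θ(S²×ℝ²) < Θ(S³×ℝ)` ⟺ `e < π`: the top non-flat KÄHLER density of real dimension 4 (`2/e`, attained by
`ℂ×ℙ¹`; Li–Wang arXiv:2301.09784 Thm 1.1 + the cycle-1 toric computation) is below the cylinder, so the whole
Kähler world satisfies NoncompactShrinkerGap/CompactShrinkerGap with margin `.0552`. [folklore] -/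
theorem thetaS2R2_lt_thetaCyl : thetaS2R2 < thetaCyl := by
  unfold thetaS2R2 thetaCyl
  rw [exp_neg_three_halves]
  have hE0 := Real.exp_pos 1
  have hs0 := Real.exp_pos (1 / 2)
  rw [show (2 : ℝ) / Real.exp 1 = 2 * Real.exp (1 / 2) * (Real.exp 1 * Real.exp (1 / 2))⁻¹ by
    field_simp]
  have hinv : 0 < (Real.exp 1 * Real.exp (1 / 2))⁻¹ := inv_pos.2 (mul_pos hE0 hs0)
  exact mul_lt_mul_of_pos_right (by linarith [exp_half_lt_sqrt_pi]) hinv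

/-- `Θ(S³×ℝ) < Θ(S⁴)` ⟺ `πe < 9`: the sphere tops the cylinder (ratio 1.0266); this is the whole window of the
route. [folklore] -/
theorem thetaCyl_lt_thetaSph : thetaCyl < thetaSph := by
  unfold thetaCyl thetaSph
  rw [exp_neg_three_halves, exp_two_eq]
  have hE0 := Real.exp_pos 1
  have hs0 := Real.exp_pos (1 / 2)
  have hp0 : 0 < Real.sqrt Real.pi := Real.sqrt_pos.2 Real.pi_pos
  -- key: √π · e < 3 · √e  ⟺  π e² < 9 e ⟺ π e < 9
  have hkey : Real.sqrt Real.pi * Real.exp 1 < 3 * Real.exp (1 / 2) := by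
    have h0 : (0 : ℝ) ≤ Real.sqrt Real.pi * Real.exp 1 := by positivity
    have h1 : (0 : ℝ) ≤ 3 * Real.exp (1 / 2) := by positivity
    refine (mul_self_lt_mul_self_iff h0 h1).2 ?_
    have eq1 : Real.sqrt Real.pi * Real.exp 1 * (Real.sqrt Real.pi * Real.exp 1)
        = Real.pi * (Real.exp 1 * Real.exp 1) := by
      linear_combination (Real.exp 1 * Real.exp 1) * sqrt_pi_sq
    have eq2 : (3 : ℝ) * Real.exp (1 / 2) * (3 * Real.exp (1 / 2)) = 9 * Real.exp 1 := by
      linear_combination (9 : ℝ) * exp_half_sq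
    rw [eq1, eq2]
    have hpi := Real.pi_lt_d2
    nlinarith [e_lt_272, hE0, Real.pi_pos]
  rw [show 2 * Real.sqrt Real.pi * (Real.exp 1 * Real.exp (1 / 2))⁻¹
      = (2 * Real.sqrt Real.pi) / (Real.exp 1 * Real.exp (1 / 2)) from (div_eq_mul_inv _ _).symm]
  rw [div_lt_div_iff₀ (by positivity) (by positivity)]
  nlinarith [hkey, hE0, hs0]

/-- `Θ(S⁴) < 1 = Θ(ℝ⁴)` ⟺ `6 < e²`. [folklore] -/
theorem thetaSph_lt_one : thetaSph < 1 := by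
  unfold thetaSph
  rw [div_lt_one (Real.exp_pos 2), exp_two_eq]
  nlinarith [e_gt_271]

/-- `Θ(ℂP²) < Θ(S²×ℝ²)` ⟺ `9 < 4e`. [folklore] -/
theorem thetaCP2_lt_thetaS2R2 : thetaCP2 < thetaS2R2 := by
  unfold thetaCP2 thetaS2R2
  rw [exp_two_eq, div_lt_div_iff₀ (by positivity) (Real.exp_pos 1)]
  nlinarith [e_gt_271, Real.exp_pos 1]

/-- `Θ(S²×S²) < Θ(ℂP²)` ⟺ `8 < 9`. [folklore] -/
theorem thetaS2S2_lt_thetaCP2 : thetaS2S2 < thetaCP2 := by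
  unfold thetaS2S2 thetaCP2
  rw [div_lt_div_iff₀ (Real.exp_pos 2) (by positivity)]
  nlinarith [Real.exp_pos 2]

/-- **Orbifold margin.** `1/2 < Θ(S³×ℝ)` ⟺ `e³ < 16π`: an orbifold shrinker with a singular point `ℝ⁴/Γ`,
`Γ ≠ 1`, has `Θ ≤ 1/|Γ| ≤ 1/2` (Nash-entropy monotonicity on its own flow), hence is excluded by the crux's
threshold with margin `.291`; the "why it might fail" clause "(orbifold)" of the item is void. [folklore] -/
theorem half_lt_thetaCyl : (1 : ℝ) / 2 < thetaCyl := by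
  unfold thetaCyl
  rw [exp_neg_three_halves]
  have hE0 := Real.exp_pos 1
  have hs0 := Real.exp_pos (1 / 2)
  have hp0 : 0 < Real.sqrt Real.pi := Real.sqrt_pos.2 Real.pi_pos
  -- key: e·√e < 4√π ⟺ e³ < 16π
  have hkey : Real.exp 1 * Real.exp (1 / 2) < 4 * Real.sqrt Real.pi := by
    have h0 : (0 : ℝ) ≤ Real.exp 1 * Real.exp (1 / 2) := by positivity
    have h1 : (0 : ℝ) ≤ 4 * Real.sqrt Real.pi := by positivity
    refine (mul_self_lt_mul_self_iff h0 h1).2 ?_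
    have eq1 : Real.exp 1 * Real.exp (1 / 2) * (Real.exp 1 * Real.exp (1 / 2))
        = Real.exp 1 * Real.exp 1 * Real.exp 1 := by
      linear_combination (Real.exp 1 * Real.exp 1) * exp_half_sq
    have eq2 : (4 : ℝ) * Real.sqrt Real.pi * (4 * Real.sqrt Real.pi) = 16 * Real.pi := by
      linear_combination (16 : ℝ) * sqrt_pi_sq
    rw [eq1, eq2]
    have hpi := Real.pi_gt_d2
    nlinarith [e_lt_272, hE0, mul_pos hE0 hE0]
  rw [show 2 * Real.sqrt Real.pi * (Real.exp 1 * Real.exp (1 / 2))⁻¹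
      = (2 * Real.sqrt Real.pi) / (Real.exp 1 * Real.exp (1 / 2)) from (div_eq_mul_inv _ _).symm]
  rw [div_lt_div_iff₀ (by norm_num) (by positivity)]
  nlinarith [hkey]

/-- **Einstein margin of the compact gap.** `2/e² < Θ(S³×ℝ)` ⟺ `1 < πe`: a non-round Einstein metric on a
homotopy 4-sphere has `Θ ≤ 2/e² = .2707` (Hitchin + Gursky, route text), below the cylinder by `.52`; so the
Einstein sub-case of CompactShrinkerGap (10870) — the only case any line reaches — is closed modulo vending
Gursky2000, and the live risk is NON-Einstein compact shrinkers on homotopy spheres only. [folklore] -/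
theorem thetaEinsteinNonround_lt_thetaCyl : thetaEinsteinNonround < thetaCyl := by
  unfold thetaEinsteinNonround thetaCyl
  rw [exp_neg_three_halves, exp_two_eq]
  have hE0 := Real.exp_pos 1
  have hs0 := Real.exp_pos (1 / 2)
  have hp0 : 0 < Real.sqrt Real.pi := Real.sqrt_pos.2 Real.pi_pos
  -- key: √e < √π · e ⟺ 1 < π e
  have hkey : Real.exp (1 / 2) < Real.sqrt Real.pi * Real.exp 1 := by
    have h0 : (0 : ℝ) ≤ Real.exp (1 / 2) := hs0.le
    have h1 : (0 : ℝ) ≤ Real.sqrt Real.pi * Real.exp 1 := by positivity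
    refine (mul_self_lt_mul_self_iff h0 h1).2 ?_
    have eq1 : Real.sqrt Real.pi * Real.exp 1 * (Real.sqrt Real.pi * Real.exp 1)
        = Real.pi * (Real.exp 1 * Real.exp 1) := by
      linear_combination (Real.exp 1 * Real.exp 1) * sqrt_pi_sq
    rw [exp_half_sq, eq1]
    have hpi := Real.pi_gt_d2
    nlinarith [e_gt_271, hE0]
  rw [show 2 * Real.sqrt Real.pi * (Real.exp 1 * Real.exp (1 / 2))⁻¹
      = (2 * Real.sqrt Real.pi) / (Real.exp 1 * Real.exp (1 / 2)) from (div_eq_mul_inv _ _).symm]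
  rw [div_lt_div_iff₀ (by positivity) (by positivity)]
  nlinarith [hkey, hE0, hs0]

/-- `ν_cyl = log Θ(S³×ℝ)`: the crux's literal threshold is the logarithm of the cylinder density. [folklore] -/
theorem nuCyl_eq_log_thetaCyl : nuCyl = Real.log thetaCyl := by
  unfold nuCyl thetaCyl
  have hp0 : 0 < Real.sqrt Real.pi := Real.sqrt_pos.2 Real.pi_pos
  rw [Real.log_mul (by positivity) (Real.exp_pos _).ne', Real.log_mul (by norm_num) hp0.ne',
    Real.log_exp, Real.log_sqrt Real.pi_pos.le]
  ring

/-- `log Θ(S⁴) = log 6 − 2 = ν(S⁴_round)` (≈ −0.20824). [folklore] -/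
theorem log_thetaSph : Real.log thetaSph = Real.log 6 - 2 := by
  unfold thetaSph
  rw [Real.log_div (by norm_num) (Real.exp_pos 2).ne', Real.log_exp]

/-- **The round sphere clears the threshold**: `ν_cyl < log 6 − 2` (margin .02625). [folklore] -/
theorem nuCyl_lt_nuRound : nuCyl < Real.log 6 - 2 := by
  rw [nuCyl_eq_log_thetaCyl, ← log_thetaSph]
  have h0 : 0 < thetaCyl := by unfold thetaCyl; positivity
  exact Real.log_lt_log h0 thetaCyl_lt_thetaSph

/-- The literal constant of items 10868 / 10870, `32π²√π e^{−3/2}`, is `16π² · Θ(S³×ℝ)` (i.e. their bound reads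
`(4π)⁻² ∫ e^{−f} dV ≤ Θ_cyl` / `> Θ_cyl`). [folklore] -/
theorem routeConstant_eq :
    32 * Real.pi ^ 2 * Real.sqrt Real.pi * Real.exp (-(3 : ℝ) / 2) = 16 * Real.pi ^ 2 * thetaCyl := by
  unfold thetaCyl; ring

/-- `Θ(S⁴) = 96π² e⁻² / (16π²)` (the sphere `S⁴(√6)`: `R = 2`, `f ≡ 2`, `Vol = 36·8π²/3 = 96π²`). [folklore] -/
theorem thetaSph_eq : thetaSph = 96 * Real.pi ^ 2 * Real.exp (-2) / (16 * Real.pi ^ 2) := by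
  unfold thetaSph
  rw [Real.exp_neg]
  field_simp
  ring

/-- **Bishop window for the Einstein case.** An Einstein metric on a closed 4-manifold normalised `Ric = 3g`
has `Vol ≤ Vol(S⁴(1))` (Bishop), and as a shrinker `Θ = Θ(S⁴) · Vol/Vol(S⁴(1))`; so `Θ > Θ_cyl` forces
`Vol/Vol(S⁴(1)) > Θ_cyl/Θ_sph = √(πe)/3`, certified here to lie in `(0.974, 0.9742)`: an Einstein competitor
must have more than 97.4 % of the round volume (and then Gursky's gap, `thetaEinsteinNonround_lt_thetaCyl`,
leaves only the round metric on a homotopy sphere). [folklore] -/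
theorem volRatio_window :
    0.974 < thetaCyl / thetaSph ∧ thetaCyl / thetaSph < 0.9742 := by
  have hE0 := Real.exp_pos 1
  have hs0 := Real.exp_pos (1 / 2)
  have hp0 : 0 < Real.sqrt Real.pi := Real.sqrt_pos.2 Real.pi_pos
  have hratio : thetaCyl / thetaSph = Real.sqrt Real.pi * Real.exp (1 / 2) / 3 := by
    unfold thetaCyl thetaSph
    rw [exp_neg_three_halves, exp_two_eq, ← exp_half_sq]
    field_simp
    ring
  rw [hratio]
  -- square: (√π √e / 3)² = π e / 9
  have hsq : (Real.sqrt Real.pi * Real.exp (1 / 2) / 3) ^ 2 = Real.pi * Real.exp 1 / 9 := by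
    rw [div_pow, mul_pow, sq, sq, sqrt_pi_sq, exp_half_sq]; norm_num
  have hpos : 0 < Real.sqrt Real.pi * Real.exp (1 / 2) / 3 := by positivity
  have hlo : (0.974 : ℝ) ^ 2 < Real.pi * Real.exp 1 / 9 := by
    nlinarith [Real.pi_gt_d6, Real.exp_one_gt_d9, Real.pi_pos]
  have hhi : Real.pi * Real.exp 1 / 9 < (0.9742 : ℝ) ^ 2 := by
    nlinarith [Real.pi_lt_d6, Real.exp_one_lt_d9, Real.pi_pos, hE0]
  constructor
  · nlinarith [hsq, hlo, hpos]
  · nlinarith [hsq, hhi, hpos]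

/-- `Θ(FIK) = (1+√2) e^{√2−2} / 2` : the toric/U(2) Kähler shrinker on `Bl₀ ℂ² = O(−1)`:
`Θ = e^{−2} min_{a>0} e^{a}(1/a + 1/a²)`, minimum at `a = √2`. -/
def thetaFIK : ℝ := (1 + Real.sqrt 2) * Real.exp (Real.sqrt 2 - 2) / 2

/-- `1.414 < √2 < 1.4143`. [folklore] -/
private lemma sqrt2_bounds : (1.414 : ℝ) < Real.sqrt 2 ∧ Real.sqrt 2 < 1.4143 := by
  constructor
  · rw [Real.lt_sqrt (by norm_num)]; norm_num
  · rw [Real.sqrt_lt' (by norm_num)]; norm_num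

/-- `√2·√2 = 2`. [folklore] -/
private lemma sqrt2_sq : Real.sqrt 2 * Real.sqrt 2 = 2 := Real.mul_self_sqrt (by norm_num)

/-- `Θ(ℂP²) < Θ(FIK)` ⟺ `9 < (1+√2) e^{√2}` (via `e^{√2} = e · e^{√2−1} ≥ e√2`). [folklore] -/
theorem thetaCP2_lt_thetaFIK : thetaCP2 < thetaFIK := by
  unfold thetaCP2 thetaFIK
  obtain ⟨hs1, hs2⟩ := sqrt2_bounds
  have hE0 := Real.exp_pos 1
  have hE := Real.exp_one_gt_d9
  -- e^{√2 - 2} = e^{√2 - 1} / e ... write exp(√2 - 2) * exp 2 = exp(√2)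
  have hkey : 9 < (1 + Real.sqrt 2) * Real.exp (Real.sqrt 2) := by
    have h1 : Real.sqrt 2 * Real.exp 1 ≤ Real.exp (Real.sqrt 2) := by
      have := Real.add_one_le_exp (Real.sqrt 2 - 1)
      have h2 : Real.exp (Real.sqrt 2) = Real.exp (Real.sqrt 2 - 1) * Real.exp 1 := by
        rw [← Real.exp_add]; ring_nf
      rw [h2]
      have : Real.sqrt 2 ≤ Real.exp (Real.sqrt 2 - 1) := by linarith
      exact mul_le_mul_of_nonneg_right this hE0.le
    have h2 := mul_le_mul_of_nonneg_left h1 (by positivity : (0:ℝ) ≤ 1 + Real.sqrt 2)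
    have h3' : (1 + Real.sqrt 2) * (Real.sqrt 2 * Real.exp 1) = (Real.sqrt 2 + 2) * Real.exp 1 := by
      linear_combination (Real.exp 1) * sqrt2_sq
    have h4 : (3.414 : ℝ) * 2.7182818283 ≤ (Real.sqrt 2 + 2) * Real.exp 1 :=
      mul_le_mul (by linarith) hE.le (by norm_num) (by linarith)
    nlinarith [h2, h3', h4]
  have h3 : Real.exp (Real.sqrt 2 - 2) * Real.exp 2 = Real.exp (Real.sqrt 2) := by
    rw [← Real.exp_add]; ring_nf
  rw [div_lt_div_iff₀ (by positivity) (by norm_num)]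
  nlinarith [h3, hkey, Real.exp_pos 2, Real.exp_pos (Real.sqrt 2 - 2)]

/-- **FIK sits below the bubble sheet**: `Θ(FIK) < Θ(S²×ℝ²)` ⟺ `(1+√2) e^{√2−1} < 4` (via `e^{y} ≤ 1/(1−y)`,
`y = (√2−1)/2`, twice). With `thetaCP2_lt_thetaFIK` the certified chain reads
`S²×S² < ℂP² < FIK < S²×ℝ² < S³×ℝ < S⁴ < 1`. [folklore] -/
theorem thetaFIK_lt_thetaS2R2 : thetaFIK < thetaS2R2 := by
  unfold thetaFIK thetaS2R2
  obtain ⟨hs1, hs2⟩ := sqrt2_bounds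
  have hE0 := Real.exp_pos 1
  set y : ℝ := (Real.sqrt 2 - 1) / 2 with hy
  have hy0 : 0 < y := by rw [hy]; linarith
  have hy1 : y < 0.20715 := by rw [hy]; linarith
  -- e^{y} (1 - y) ≤ 1
  have hexp_y : Real.exp y * (1 - y) ≤ 1 := by
    have h := Real.add_one_le_exp (-y)   -- -y + 1 ≤ exp (-y)
    have h' : Real.exp y * Real.exp (-y) = 1 := by rw [← Real.exp_add]; simp
    nlinarith [Real.exp_pos y, h, h']
  have hexp_yy : Real.exp (Real.sqrt 2 - 1) = Real.exp y * Real.exp y := by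
    rw [← Real.exp_add, hy]; ring_nf
  -- bound: exp(√2 - 1) * (1-y)^2 ≤ 1
  have hb : Real.exp (Real.sqrt 2 - 1) * (1 - y) ^ 2 ≤ 1 := by
    rw [hexp_yy]
    have h1y : 0 ≤ 1 - y := by linarith
    nlinarith [hexp_y, Real.exp_pos y, mul_nonneg (Real.exp_pos y).le h1y]
  -- target: (1+√2) exp(√2-2)/2 < 2/exp 1  ⟺ (1+√2) exp(√2-1) < 4
  have h3 : Real.exp (Real.sqrt 2 - 2) * Real.exp 1 = Real.exp (Real.sqrt 2 - 1) := by
    rw [← Real.exp_add]; ring_nf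
  rw [div_lt_div_iff₀ (by norm_num) hE0]
  -- (1+√2) exp(√2-2) * exp 1 < 2 * 2
  have hfin : (1 + Real.sqrt 2) * Real.exp (Real.sqrt 2 - 1) < 4 := by
    -- (1-y)^2 ≥ (1 - 0.20715)^2 > 0.6286 and (1+√2) < 2.4143 ⇒ (1+√2)/(1-y)^2 < 3.841
    have h1y2 : (0.6286 : ℝ) < (1 - y) ^ 2 := by nlinarith
    have hpos : 0 < Real.exp (Real.sqrt 2 - 1) := Real.exp_pos _
    nlinarith [hb, h1y2, hpos, hs2]
  nlinarith [hfin, h3, Real.exp_pos (Real.sqrt 2 - 2)]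

/-- **Quotients are harmless**: `Θ(ℝP⁴) = Θ(S⁴)/2 < Θ(S³×ℝ)` ⟺ `9 < 4πe` (`Θ(N/Γ) = Θ(N)/|Γ|`). [folklore] -/
theorem thetaSph_half_lt_thetaCyl : thetaSph / 2 < thetaCyl := by
  unfold thetaSph thetaCyl
  have hE0 := Real.exp_pos 1
  have hs0 := Real.exp_pos (1 / 2)
  have hp0 : 0 < Real.sqrt Real.pi := Real.sqrt_pos.2 Real.pi_pos
  have exp_two_eq' : Real.exp 2 = Real.exp 1 * Real.exp 1 := by rw [← Real.exp_add]; norm_num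
  have exp_half_sq' : Real.exp (1 / 2) * Real.exp (1 / 2) = Real.exp 1 := by rw [← Real.exp_add]; norm_num
  have e32 : Real.exp (-(3 : ℝ) / 2) = (Real.exp 1 * Real.exp (1 / 2))⁻¹ := by
    rw [← Real.exp_add, ← Real.exp_neg]; norm_num
  have sqrt_pi_sq' : Real.sqrt Real.pi * Real.sqrt Real.pi = Real.pi := Real.mul_self_sqrt Real.pi_pos.le
  rw [e32, exp_two_eq']
  -- key: 3 √e < 2 √π e ⟺ 9 e < 4 π e² ⟺ 9 < 4 π e
  have hkey : 3 * Real.exp (1 / 2) < 2 * Real.sqrt Real.pi * Real.exp 1 := by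
    have h0 : (0 : ℝ) ≤ 3 * Real.exp (1 / 2) := by positivity
    have h1 : (0 : ℝ) ≤ 2 * Real.sqrt Real.pi * Real.exp 1 := by positivity
    refine (mul_self_lt_mul_self_iff h0 h1).2 ?_
    have eq1 : (3 : ℝ) * Real.exp (1 / 2) * (3 * Real.exp (1 / 2)) = 9 * Real.exp 1 := by
      linear_combination (9 : ℝ) * exp_half_sq'
    have eq2 : 2 * Real.sqrt Real.pi * Real.exp 1 * (2 * Real.sqrt Real.pi * Real.exp 1)
        = 4 * Real.pi * (Real.exp 1 * Real.exp 1) := by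
      linear_combination (4 * Real.exp 1 * Real.exp 1) * sqrt_pi_sq'
    rw [eq1, eq2]
    have hpi := Real.pi_gt_d2
    nlinarith [Real.exp_one_gt_d9, hE0]
  rw [show (6 : ℝ) / (Real.exp 1 * Real.exp 1) / 2 = 3 / (Real.exp 1 * Real.exp 1) by ring]
  rw [show 2 * Real.sqrt Real.pi * (Real.exp 1 * Real.exp (1 / 2))⁻¹
      = (2 * Real.sqrt Real.pi) / (Real.exp 1 * Real.exp (1 / 2)) from (div_eq_mul_inv _ _).symm]
  rw [div_lt_div_iff₀ (by positivity) (by positivity)]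
  nlinarith [hkey, hE0, hs0]


/-! ## §4 Non-vacuity: the round `S⁴` meets the PSC hypothesis with the TREE's definitions -/

/-- `finrank ℝ ℝ⁵ = 4 + 1`, as the `Fact` the sphere instances want (LOCAL instance only). [folklore] -/
theorem factFinrankFive : Fact (Module.finrank ℝ (EuclideanSpace ℝ (Fin 5)) = 4 + 1) :=
  ⟨by simp⟩

attribute [local instance] factFinrankFive

/-- **`R > 0` is satisfiable on the summit's own `S⁴`, with the tree's `scalarCurvature`.** The round metric
of `S⁴ ⊂ ℝ⁵` is a `C^∞` Riemannian metric with Levi-Civita instance (`hasLeviCivita`, a theorem) and scalar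
curvature `12 > 0` (`scalarCurvature_roundMetric_pos`, proved from the Gauss equation in the tree; axioms
propext / Classical.choice / Quot.sound). Hence the crux is NOT vacuously provable through `hR`. [folklore] -/
theorem roundSphere_psc :
    ∃ (g : PseudoRiemannianMetric (𝓡 4) ∞ (EuclideanSpace ℝ (Fin 4)) (TangentSpace (𝓡 4) : 𝕊⁴ → Type _))
      (_ : g.HasLeviCivita), g.IsRiemannian ∧ ∀ x, 0 < g.scalarCurvature x := by
  haveI := (roundMetric (n := 4) (EuclideanSpace ℝ (Fin 5))).hasLeviCivita
  exact ⟨roundMetric (n := 4) (EuclideanSpace ℝ (Fin 5)), ‹_›, isRiemannian_roundMetric,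
    fun x => scalarCurvature_roundMetric_pos _ (by norm_num) x⟩

end Summit.SmoothPoincare4.SmoothPoincare4.Theorems.SubcylindricalRecognition.Negative

end
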